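import Summits.CriticalPhenomena.PercolationContinuityZ3.Theorems.Transplant.SkelSign2ParamsAtQ
import HarnessLib

/-!
# D″ L7′ params, part 7b: THE SHARED NEAR/FAR DEPTH THRESHOLD `Sgn.r₀` of every window kit call ((R)/(F)/(C)) — `r₀ := rs + 6M + 4 + ψ(topScale)`:
# above the kit's own rooms (`hr₀₁ hr₀₂` of `kitClause_stepI`, which `Prm.rs` already meets) AND above the ROUTE depth of every certified extent
# (`hdepth : 2ℓs + 2 + tanOff ℓs M + A I I + ψ(amax (widths a ℓ)) ≤ r₀` for all `D.k ≤ ℓ ≤ Smax`, both axes), and still below the collar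
# `L′` (`r₀ ≤ L′`, so `hr₀L`/`hr₀L'` of the residues and `hR : r₀ ≤ window depth` hold) — ledger SIGN-PARAMS.md §1K/§9

builds on p205010 (kernel theorem, internal audit signed; external expert review pending) — nothing in this file uses p205010.
Lane `prim-bschramm-*`, seat `prim-bschramm-stmt` (gen 9); helper file (`--supports stmt-CriticalPhenomena-4575`).
(`Prm.rs` remains the SHELL radius `rs` of the kit: `hrs₁ hrs₂`, `B = (Δ+1)^{2rs}`; the route prisms at extents up to `L·emax` are deeper than
the kit slab, hence the separate threshold.) [cite: KozmaNitzan2024, §4 Lemma 10 Steps III–V (pp. 19–22)]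
-/

noncomputable section

open scoped Classical

namespace Summit.CriticalPhenomena.PercolationContinuityZ3.Theorems.Transplant

namespace PlanarSkeletonSign

namespace Sgn₂

open Literature.Probability.Percolation Literature.Probability.LatticeModels SimpleGraph
open SkelConc (Consts)
open Sgn (K a A L twenty_le_K one_le_a hundred_le_A K_le_A five_le_L sixteen_L_le_A δkit δI m₀ Mu ρz M T₀ Kd Rseed rs cU sB B kP NP Lcnt Rlev R' η reachK Sz L_hyps)
open SkelI (tanOff)

section Defs

variable (κ : Consts) {V : Type} [DecidableEq V] [Countable V] {G : SimpleGraph V} [G.LocallyFinite] (Φ : PlanarSkeletonSign G)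
  (p : unitInterval) (O : Skelφ.StepI.Out V)

/-- **The near/far depth threshold** `r₀ := rs + 6M + 4 + ψ(topScale)`. [this work] -/
def r₀ : ℕ := rs Φ O + 6 * M O + 4 + O.D.R (topScale κ Φ p O)

end Defs

section AtQ

variable {κ : Consts} {V : Type} [DecidableEq V] [Countable V] {G : SimpleGraph V} [G.LocallyFinite] {Φ : PlanarSkeletonSign G}
  {t : V} {p : unitInterval} {hC : Φ.CylSubcritical p} {O : Skelφ.StepI.Out V} {q : unitInterval}
  (hat : (choiceAt κ Φ t p hC).AtQ O q)
include hat

omit hat in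
/-- **The kit rooms at `r₀`**: `M + 1 + T₀ + Rseed ≤ r₀` (`hr₀₁`), `M + 2 + T₀ + Kd ≤ r₀` (`hr₀₂`), `rs ≤ r₀`. [folklore] -/
theorem r₀_kit_at : M O + 1 + tanOff (M O) (M O) + Rseed Φ O ≤ r₀ κ Φ p O ∧ M O + 2 + tanOff (M O) (M O) + Kd O ≤ r₀ κ Φ p O ∧
    rs Φ O ≤ r₀ κ Φ p O := by
  have h1 := Skelφ.Prm.hr₀₁ O.D (Mu O) G Φ.φ Φ.types (ρz O)
  have h2 := Skelφ.Prm.hr₀₂ O.D (Mu O) G Φ.φ Φ.types (ρz O)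
  unfold r₀ rs Rseed Kd M; refine ⟨?_, ?_, ?_⟩ <;> omega

/-- The larger half-width of a certified band rectangle is at most `topScale`: `D.k ≤ ℓ ≤ Smax ⇒ amax (widths a ℓ) ≤ topScale`. [folklore] -/
theorem amax_widths_le_topScale (a : Fin 2) {ℓ : ℕ} (hk : O.D.k ≤ ℓ) (hℓ : ℓ ≤ Smax κ Φ p O) :
    Skelφ.amax (Skelφ.StepI.widths O.D.Gb O.D.Fb a ℓ) ≤ topScale κ Φ p O := by
  have hm := Gb_Fb_mono_at hat hk hℓ
  have hw : Skelφ.amax (Skelφ.StepI.widths O.D.Gb O.D.Fb a ℓ) ≤ max ℓ (max (O.D.Gb ℓ) (O.D.Fb ℓ)) := by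
    unfold Skelφ.amax
    refine max_le ?_ ?_ <;> fin_cases a <;> simp [Skelφ.StepI.widths]
  unfold topScale; omega

/-- **`hdepth` at `r₀`** for every axis, every kit index and every certified extent `D.k ≤ ℓ ≤ Smax`:
`2ℓs + 2 + tanOff ℓs M + A I I + ψ(amax (widths a ℓ)) ≤ r₀` (`ℓs = M`, `A I I = Mu + 1 ≤ M`). [folklore] -/
theorem hdepth_at (a I : Fin 2) {ℓ : ℕ} (hk : O.D.k ≤ ℓ) (hℓ : ℓ ≤ Smax κ Φ p O) :
    2 * M O + 2 + tanOff (M O) (M O) + Skelφ.Prm.A O.D (Mu O) I I + O.D.R (Skelφ.amax (Skelφ.StepI.widths O.D.Gb O.D.Fb a ℓ)) ≤ r₀ κ Φ p O := by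
  have hψ : O.D.R = Skelφ.fatRadius Φ.frame hC := (R_Λ_eq hat).1
  have hmono : Monotone O.D.R := by rw [hψ]; exact Skelφ.fatRadius_mono Φ.frame hC
  have h1 := hmono (amax_widths_le_topScale hat a hk hℓ)
  have hA : Skelφ.Prm.A O.D (Mu O) I I ≤ M O := Skelφ.Prm.hA O.D (Mu O) I I
  have hT : tanOff (M O) (M O) = 3 * M O + 2 := by unfold tanOff; omega
  unfold r₀; omega

/-- `hdepth` on the per-axis route range `Icc (ℓ₀ a) (ℓtop a)` and on the merged range `Icc Smin Smax`. [folklore] -/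
theorem hdepth_range_at (a I : Fin 2) {ℓ : ℕ} (h₀ : Smin κ Φ p O ≤ ℓ) (h₁ : ℓ ≤ Smax κ Φ p O) :
    2 * M O + 2 + tanOff (M O) (M O) + Skelφ.Prm.A O.D (Mu O) I I + O.D.R (Skelφ.amax (Skelφ.StepI.widths O.D.Gb O.D.Fb a ℓ)) ≤ r₀ κ Φ p O :=
  hdepth_at hat a I ((Smin_Smax_at hat 0).2.2.2.trans h₀) h₁

/-- **`r₀ + 3 ≤ L′`** (indeed `r₀ + ψMz + 12 ≤ L′`; p5's `hr₀L`: the plain kit window of depth `(E − L′) + r₀` sits `≥ 3` inside the habitat). [folklore] -/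
theorem r₀_add_three_le_Lp : r₀ κ Φ p O + 3 ≤ Skelφ.Prm.Lp (schedIn κ Φ p O q) := by
  have hrk : rs Φ O ≤ reachK Φ O := by unfold reachK; omega
  have hS := Smin_Smax_at hat 0
  have hM : M O ≤ topScale κ Φ p O := by
    have h1 : Mu O + 1 ≤ M O := Skelφ.Prm.Mu_succ_le_M O.D (Mu O)
    have h2 : M O ≤ e κ Φ p O 0 := by have := (units_large_at hat 0).2.2.1; have := hundred_le_A κ; nlinarith
    have h3 : e κ Φ p O 0 ≤ Smax κ Φ p O := (extents_le_at hat 0).2.1.trans ((extents_le_at hat 0).2.2.1.trans hS.2.1)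
    unfold topScale; omega
  have hM1 : 1 ≤ M O := Skelφ.Prm.one_le_M O.D (Mu O)
  show r₀ κ Φ p O + 3 ≤ Skelφ.Prm.LA (schedIn κ Φ p O q) + (schedIn κ Φ p O q).ψtop + (schedIn κ Φ p O q).ψM + 12 * (schedIn κ Φ p O q).u +
    2 * (schedIn κ Φ p O q).M + (schedIn κ Φ p O q).reachK
  show r₀ κ Φ p O + 3 ≤ Skelφ.Prm.LA (schedIn κ Φ p O q) + O.D.R (topScale κ Φ p O) + ψMz O + 12 * topScale κ Φ p O + 2 * M O + reachK Φ O
  unfold r₀; omega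

/-- **`r₀ ≤ L′`** ((F)/(R)'s `hr₀L'`/`hr₀L`). [folklore] -/
theorem r₀_le_Lp : r₀ κ Φ p O ≤ Skelφ.Prm.Lp (schedIn κ Φ p O q) := le_trans (Nat.le_add_right _ _) (r₀_add_three_le_Lp hat)

/-- `r₀ ≤ E₀` and `r₀ + 1 ≤ gap ρ` (`hgap₀` of the face step). [folklore] -/
theorem r₀_le_E₀_gap (ρ : ℕ) : r₀ κ Φ p O ≤ Skelφ.Prm.E₀ (schedIn κ Φ p O q) ∧ r₀ κ Φ p O + 1 ≤ Skelφ.Prm.gap (schedIn κ Φ p O q) ρ := by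
  have h := r₀_le_Lp hat (q := q)
  have hE := Skelφ.Prm.Lp_le_E₀ (schedIn κ Φ p O q)
  have hg := Skelφ.Prm.gap_eq (schedIn κ Φ p O q) ρ
  exact ⟨h.trans hE, by omega⟩

end AtQ

end Sgn₂

end PlanarSkeletonSign

end Summit.CriticalPhenomena.PercolationContinuityZ3.Theorems.Transplant

end
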